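import Mathlib
import HarnessLib
import Literature.Probability.LatticeModels.TorusFourierFirstMoment
import Literature.MathematicalPhysics.QuantumLattice.FramePosKernelL1
import Summits.HubbardSuperconductivity.HubbardSuperconductivity.Theorems.KLProgrammeKLRegimeEngineFramePosKernelBound
import Summits.HubbardSuperconductivity.HubbardSuperconductivity.Theorems.KLProgrammeKLRegimeEngineFramePosKernelPieces

/-!
# K3 ENGINE child (stmt-HubbardSuperconductivity-19918 `KLRegimeEngineV14`), stub `stub_engine_scale0`, clause (E4)₀ (route (E4-b)):
# the FIRST MOMENT of an admissible frame's lattice position kernel, `Σ_z |z̃_j|·‖Ǩ_L(z)‖ = O((N+1)·U²)`, uniform in `L`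

Cell gate-hubbard-kl, seat p3 (g6).  (E4)₀ `EngineFirstMoments … 0` is a first spacetime MOMENT of the scale-`0` quartic kernel; on the
weighted determinant-bound route (`GrassmannWeightedEffectiveActionBound`, tree weights `1 + c·diam`) the counterterm vertex `𝒩_{K,N}` enters
through the weighted pinned norm `(β/N)·Σ_z (1 + |z̃|)·‖Ǩ_L(z)‖` of the frame's position kernel.  Plan g12's (E4-b) ruling (03:10Z) asked for a
route that does not read the order-`0` law of `FrameOK` (ii): here the first moment is bounded PER FRAME PIECE from the orders `j = 1, 2, 3`
ONLY, at the piece's own length `R = 4ⁿ` (`Literature/…/TorusFourierFirstMoment`): piece `n` (`‖D¹‖ ≤ Gfr1·U²·4^{-n}`, `‖D²‖ ≤ Gfr2·U²`,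
`‖D³‖ ≤ Gfr3·U²·4ⁿ`) costs `6U²·(πGfr1/2 + π²Gfr2/(2√2) + π³Gfr3/8)` — UNIFORM in `n` — so the whole frame costs `(N+1)` times that,
i.e. `O(c + U²)` in the KL regime (`(N+1)·U² ≤ c/ln 4 + 2U²`), inside (E4)₀'s tolerance (`c ≤ klEngC₃3 ≤ 2^{-120}`).

* `norm_iteratedFDeriv_two_sub_le`, `abs_third_diff_le_of_iteratedFDeriv_three` — third mixed differences from `‖D³f‖`;
* `eval_latticeMomentum_add_single_three` — three unit lattice shifts are continuum shifts by `2π/L`;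
* `sum_abs_mul_norm_framePosKernel_le_of_derivs` — one `C³` frame piece at scale `R`;
* **`sum_abs_mul_norm_framePosKernel_le_of_frameOK`** — `Σ_z |z̃_j|·‖Ǩ_L(z)‖ ≤ (N+1)·U²·6(πGfr1/2 + π²Gfr2/(2√2) + π³Gfr3/8)` for every
  admissible frame `FrameOK R U N μ K` (`Gfr j ≥ 0`), every direction `j`, every `L`.

What this does NOT give: the first moments of the scale-`0` COVARIANCE and MULTIPLIER kernels (symbols `u(ν²+e_K²)/(−iν+e_K)`, `C₀⁻¹(√(ν²+e_K²))`
— smooth non-analytic profiles COMPOSED with `e_K`, whose `C³` size is `≍ Gfr3·U²·4^N`); see the seat's (E4)₀ note on the cell bus.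
Everything is proved; no definitions, no named facts, no sorry.
-/

noncomputable section

namespace Summit.HubbardSuperconductivity.HubbardSuperconductivity.Theorems.EngineV8

set_option linter.dupNamespace false -- summit = problem name (single-conjunct summit), D-0017

open Real Finset Literature.MathematicalPhysics.QuantumLattice Literature.Probability.LatticeModels
open Summit.HubbardSuperconductivity.HubbardSuperconductivity.Theorems.KLRegimeSplit
open Summit.HubbardSuperconductivity.HubbardSuperconductivity.Theorems.DispersionFlow
open scoped ComplexConjugate

/-! ## §1 Third mixed differences from the third derivative -/

/-- **`D²f` is `K₃`-Lipschitz when `‖D³f‖ ≤ K₃`**: `‖D²f(x + w) − D²f(x)‖ ≤ K₃‖w‖`. -/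
theorem norm_iteratedFDeriv_two_sub_le {f : Momentum → ℝ} (hf : ContDiff ℝ 3 f) {K₃ : ℝ}
    (hK₃ : ∀ q, ‖iteratedFDeriv ℝ 3 f q‖ ≤ K₃) (x w : Momentum) :
    ‖iteratedFDeriv ℝ 2 f (x + w) - iteratedFDeriv ℝ 2 f x‖ ≤ K₃ * ‖w‖ := by
  have hd : Differentiable ℝ (fun y => iteratedFDeriv ℝ 2 f y) := hf.differentiable_iteratedFDeriv (by norm_num)
  have hb : ∀ y ∈ (Set.univ : Set Momentum), ‖fderiv ℝ (fun y => iteratedFDeriv ℝ 2 f y) y‖ ≤ K₃ := fun y _ => by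
    rw [show (fun y => iteratedFDeriv ℝ 2 f y) = iteratedFDeriv ℝ 2 f from rfl, norm_fderiv_iteratedFDeriv]; exact hK₃ y
  have h := Convex.norm_image_sub_le_of_norm_fderiv_le (fun y _ => hd y) hb convex_univ (Set.mem_univ x) (Set.mem_univ (x + w))
  rwa [add_sub_cancel_left] at h

/-- **Third mixed differences**: `|Δ_w Δ_v Δ_u f(a)| ≤ K₃‖u‖‖v‖‖w‖` when `‖D³f‖ ≤ K₃` (apply the second-difference bound to `f(·+w) − f`,
whose second derivative is `K₃‖w‖`-small). -/
theorem abs_third_diff_le_of_iteratedFDeriv_three {f : Momentum → ℝ} (hf : ContDiff ℝ 3 f) {K₃ : ℝ}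
    (hK₃ : ∀ q, ‖iteratedFDeriv ℝ 3 f q‖ ≤ K₃) (a u v w : Momentum) :
    |(f (a + u + v + w) - f (a + u + w) - f (a + v + w) + f (a + w)) - (f (a + u + v) - f (a + u) - f (a + v) + f a)| ≤
      K₃ * ‖u‖ * ‖v‖ * ‖w‖ := by
  set φ : Momentum → ℝ := fun x => f (x + w) - f x with hφ
  have hf2 : ContDiff ℝ 2 f := hf.of_le (by norm_num)
  have hφ2 : ContDiff ℝ 2 φ := (hf2.comp (contDiff_id.add contDiff_const)).sub hf2
  have hφb : ∀ q, ‖iteratedFDeriv ℝ 2 φ q‖ ≤ K₃ * ‖w‖ := by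
    intro q
    have hsub : iteratedFDeriv ℝ 2 φ q = iteratedFDeriv ℝ 2 (fun x => f (x + w)) q - iteratedFDeriv ℝ 2 f q := by
      rw [hφ, show (fun x => f (x + w) - f x) = (fun x => f (x + w)) - f from rfl]
      exact iteratedFDeriv_sub_apply ((hf2.comp (contDiff_id.add contDiff_const)).contDiffAt) hf2.contDiffAt
    rw [hsub, iteratedFDeriv_comp_add_right]
    exact norm_iteratedFDeriv_two_sub_le hf hK₃ q w
  have h := abs_second_diff_le_of_iteratedFDeriv_two hφ2 hφb a u v
  have hre : φ (a + u + v) - φ (a + u) - φ (a + v) + φ a =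
      (f (a + u + v + w) - f (a + u + w) - f (a + v + w) + f (a + w)) - (f (a + u + v) - f (a + u) - f (a + v) + f a) := by
    simp only [hφ]; ring
  rw [hre] at h
  calc _ ≤ K₃ * ‖w‖ * ‖u‖ * ‖v‖ := h
    _ = K₃ * ‖u‖ * ‖v‖ * ‖w‖ := by ring

/-! ## §2 Three unit lattice shifts are continuum shifts -/

section Lattice

variable {L : ℕ} [NeZero L]

/-- `K(p_{q + e_j + e_i + e_k}) = K(p_q + (2π/L)e_j + (2π/L)e_i + (2π/L)e_k)` (periodicity of the frame). -/
theorem eval_latticeMomentum_add_single_three (K : TrigPolyC4v) (q : TorusSite 2 L) (j i k : Fin 2) :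
    K.eval (latticeMomentum L (q + Pi.single j 1 + Pi.single i 1 + Pi.single k 1)) =
      K.eval (latticeMomentum L q + (2 * Real.pi / L) • (Pi.single j (1 : ℝ) : Fin 2 → ℝ) +
        (2 * Real.pi / L) • (Pi.single i (1 : ℝ) : Fin 2 → ℝ) + (2 * Real.pi / L) • (Pi.single k (1 : ℝ) : Fin 2 → ℝ)) := by
  -- peel the first shift by periodicity, then the two-shift identity at the base `q + e_j`
  rw [eval_latticeMomentum_add_single_add_single K (q + Pi.single j 1) i k]
  obtain ⟨z, hz⟩ := latticeMomentum_add_smul_single_eq q j 1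
  rw [one_smul, Nat.cast_one, one_mul] at hz
  rw [hz]
  have h : ((fun l' => (latticeMomentum L q + (2 * Real.pi / L) • (Pi.single j (1 : ℝ) : Fin 2 → ℝ)) l' + z l' * (2 * Real.pi)) +
        (2 * Real.pi / L) • (Pi.single i (1 : ℝ) : Fin 2 → ℝ) + (2 * Real.pi / L) • (Pi.single k (1 : ℝ) : Fin 2 → ℝ) : Fin 2 → ℝ) =
      fun l => (latticeMomentum L q + (2 * Real.pi / L) • (Pi.single j (1 : ℝ) : Fin 2 → ℝ) +
        (2 * Real.pi / L) • (Pi.single i (1 : ℝ) : Fin 2 → ℝ) + (2 * Real.pi / L) • (Pi.single k (1 : ℝ) : Fin 2 → ℝ)) l + z l * (2 * Real.pi) := by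
    funext l
    simp only [Pi.add_apply, Pi.smul_apply]
    ring
  rw [h, TrigPolyC4v.eval_periodic]

/-! ## §3 One `C³` frame piece at scale `R` -/

/-- The Euclidean length of `(2π/L)e_j` on `Momentum`. -/
theorem norm_toLp_step (j : Fin 2) : ‖WithLp.toLp 2 ((2 * Real.pi / L) • (Pi.single j (1 : ℝ) : Fin 2 → ℝ))‖ = 2 * Real.pi / L := by
  have hL : (0 : ℝ) < L := Nat.cast_pos.2 (Nat.pos_of_ne_zero (NeZero.ne L))
  rw [norm_toLp_smul_single, abs_of_pos (by positivity)]

/-- **First moment of one frame piece's position kernel**: if `‖D¹(evalM A)‖ ≤ ℓ`, `‖D²(evalM A)‖ ≤ D`, `‖D³(evalM A)‖ ≤ E` on `Momentum`,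
then for every integer scale `R ≥ 1` and direction `j`: `Σ_z |z̃_j|·‖Ǎ_L(z)‖ ≤ 6R·(πℓ/2 + π²D/(2√2·R) + π³E/(8R²))`. -/
theorem sum_abs_mul_norm_framePosKernel_le_of_derivs (A : TrigPolyC4v) {ℓ D E : ℝ} (hℓ : 0 ≤ ℓ) (hD : 0 ≤ D) (hE : 0 ≤ E)
    (h1 : ∀ q, ‖iteratedFDeriv ℝ 1 (evalM A) q‖ ≤ ℓ) (h2 : ∀ q, ‖iteratedFDeriv ℝ 2 (evalM A) q‖ ≤ D)
    (h3 : ∀ q, ‖iteratedFDeriv ℝ 3 (evalM A) q‖ ≤ E) {R : ℕ} (hR : 1 ≤ R) (j : Fin 2) :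
    ∑ z : TorusSite 2 L, |((z j).valMinAbs : ℝ)| * ‖framePosKernel L A z‖ ≤
      6 * (R : ℝ) * (Real.pi * ℓ / 2 + Real.pi ^ 2 * D / (2 * Real.sqrt 2 * R) + Real.pi ^ 3 * E / (8 * (R : ℝ) ^ 2)) := by
  have hL : (0 : ℝ) < L := Nat.cast_pos.2 (Nat.pos_of_ne_zero (NeZero.ne L))
  have hR0 : (0 : ℝ) < R := by exact_mod_cast hR
  have hπ := Real.pi_pos
  set s : ℝ := 2 * Real.pi / L with hs
  have hs0 : 0 < s := by positivity
  set g : TorusSite 2 L → ℂ := fun q => (A.eval (latticeMomentum L q) : ℂ) with hg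
  have hnorm : ∀ z, ‖framePosKernel L A z‖ = ((L : ℝ) ^ 2)⁻¹ * ‖torusFourier g z‖ := by
    intro z
    rw [framePosKernel_eq_torusFourier, norm_mul, norm_inv, norm_pow, Complex.norm_natCast]
  have hcd : ContDiff ℝ 3 (evalM A) := (contDiff_evalM A).of_le le_top
  -- the differences of the samples are continuum differences of `evalM A`
  have hev : ∀ p : Fin 2 → ℝ, A.eval p = evalM A (WithLp.toLp 2 p) := fun p => eval_eq_evalM_toLp A p
  have hstep := fun i : Fin 2 => norm_toLp_step (L := L) i
  -- Δ¹
  have hd1 : ∀ x : TorusSite 2 L, ‖g (x + Pi.single j 1) - g x‖ ≤ ℓ * s := by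
    intro x
    rw [hg]; dsimp only
    rw [← Complex.ofReal_sub, Complex.norm_real, Real.norm_eq_abs, eval_latticeMomentum_add_single, hev, hev, WithLp.toLp_add]
    have h := abs_sub_le_of_iteratedFDeriv_one ((contDiff_evalM A).of_le le_top) h1
      (WithLp.toLp 2 (latticeMomentum L x) + WithLp.toLp 2 (s • (Pi.single j (1 : ℝ) : Fin 2 → ℝ))) (WithLp.toLp 2 (latticeMomentum L x))
    rwa [add_sub_cancel_left, hstep j] at h
  -- Δ²
  have hd2 : ∀ (i : Fin 2) (x : TorusSite 2 L),
      ‖g (x + Pi.single j 1 + Pi.single i 1) - g (x + Pi.single j 1) - g (x + Pi.single i 1) + g x‖ ≤ D * s ^ 2 := by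
    intro i x
    rw [hg]; dsimp only
    rw [← Complex.ofReal_sub, ← Complex.ofReal_sub, ← Complex.ofReal_add, Complex.norm_real, Real.norm_eq_abs,
      eval_latticeMomentum_add_single_add_single, eval_latticeMomentum_add_single, eval_latticeMomentum_add_single,
      hev, hev, hev, hev, WithLp.toLp_add, WithLp.toLp_add, WithLp.toLp_add]
    have h := abs_second_diff_le_of_iteratedFDeriv_two ((contDiff_evalM A).of_le le_top) h2 (WithLp.toLp 2 (latticeMomentum L x))
      (WithLp.toLp 2 (s • (Pi.single j (1 : ℝ) : Fin 2 → ℝ))) (WithLp.toLp 2 (s • (Pi.single i (1 : ℝ) : Fin 2 → ℝ)))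
    rw [hstep j, hstep i] at h
    calc _ ≤ D * (2 * Real.pi / L) * (2 * Real.pi / L) := h
      _ = D * s ^ 2 := by rw [hs]; ring
  -- Δ³
  have hd3 : ∀ x : TorusSite 2 L,
      ‖(g (x + Pi.single j 1 + Pi.single 0 1 + Pi.single 1 1) - g (x + Pi.single j 1 + Pi.single 1 1) -
          g (x + Pi.single 0 1 + Pi.single 1 1) + g (x + Pi.single 1 1)) -
        (g (x + Pi.single j 1 + Pi.single 0 1) - g (x + Pi.single j 1) - g (x + Pi.single 0 1) + g x)‖ ≤ E * s ^ 3 := by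
    intro x
    rw [hg]; dsimp only
    have hcast : ∀ a b c d e f g' h : ℝ, ((a : ℂ) - b - c + d) - (e - f - g' + h) = (((a - b - c + d) - (e - f - g' + h) : ℝ) : ℂ) := by
      intros; push_cast; ring
    rw [hcast, Complex.norm_real, Real.norm_eq_abs, eval_latticeMomentum_add_single_three, eval_latticeMomentum_add_single_add_single,
      eval_latticeMomentum_add_single_add_single, eval_latticeMomentum_add_single, eval_latticeMomentum_add_single_add_single,
      eval_latticeMomentum_add_single, eval_latticeMomentum_add_single]
    simp only [hev, WithLp.toLp_add]
    set P := WithLp.toLp 2 (latticeMomentum L x)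
    set uj := WithLp.toLp 2 (s • (Pi.single j (1 : ℝ) : Fin 2 → ℝ))
    set u0 := WithLp.toLp 2 (s • (Pi.single (0 : Fin 2) (1 : ℝ) : Fin 2 → ℝ))
    set u1 := WithLp.toLp 2 (s • (Pi.single (1 : Fin 2) (1 : ℝ) : Fin 2 → ℝ))
    have h := abs_third_diff_le_of_iteratedFDeriv_three hcd h3 P uj u0 u1
    have huj : ‖uj‖ = s := hstep j
    have hu0 : ‖u0‖ = s := hstep 0
    have hu1 : ‖u1‖ = s := hstep 1
    rw [huj, hu0, hu1] at h
    have hre : evalM A (P + uj + u0 + u1) - evalM A (P + uj + u1) - evalM A (P + u0 + u1) + evalM A (P + u1) -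
        (evalM A (P + uj + u0) - evalM A (P + uj) - evalM A (P + u0) + evalM A P) =
        (evalM A (P + uj + u0 + u1) - evalM A (P + uj + u1) - evalM A (P + u0 + u1) + evalM A (P + u1)) -
        (evalM A (P + uj + u0) - evalM A (P + uj) - evalM A (P + u0) + evalM A P) := by ring
    rw [hre]
    calc _ ≤ E * s * s * s := h
      _ = E * s ^ 3 := by ring
  -- the torus lemma
  have hT := sum_abs_valMinAbs_mul_norm_torusFourier_le g j hR hd1 hd2 hd3
  -- rewrite the left side
  have hlhs : ∑ z : TorusSite 2 L, |((z j).valMinAbs : ℝ)| * ‖framePosKernel L A z‖ =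
      ((L : ℝ) ^ 2)⁻¹ * ∑ z : TorusSite 2 L, |((z j).valMinAbs : ℝ)| * ‖torusFourier g z‖ := by
    rw [mul_sum]
    exact sum_congr rfl fun z _ => by rw [hnorm z]; ring
  rw [hlhs]
  refine hT.trans (mul_le_mul_of_nonneg_left ?_ (by positivity))
  -- `√(L²(ℓs)²/16 + L⁴(Ds²)²/(128R²) + L⁶(Es³)²/(4096R⁴)) ≤ πℓ/2 + π²D/(2√2R) + π³E/(8R²)`
  have hsq2 : (0 : ℝ) < Real.sqrt 2 := Real.sqrt_pos.2 (by norm_num)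
  have hsq2sq : Real.sqrt 2 ^ 2 = 2 := Real.sq_sqrt (by norm_num)
  have ha : (L : ℝ) ^ 2 / 16 * (ℓ * s) ^ 2 = (Real.pi * ℓ / 2) ^ 2 := by rw [hs]; field_simp; ring
  have hb : (L : ℝ) ^ 4 / (128 * (R : ℝ) ^ 2) * (D * s ^ 2) ^ 2 = (Real.pi ^ 2 * D / (2 * Real.sqrt 2 * R)) ^ 2 := by
    rw [hs]; field_simp; rw [hsq2sq]; ring
  have hc : (L : ℝ) ^ 6 / (4096 * (R : ℝ) ^ 4) * (E * s ^ 3) ^ 2 = (Real.pi ^ 3 * E / (8 * (R : ℝ) ^ 2)) ^ 2 := by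
    rw [hs]; field_simp; ring
  rw [ha, hb, hc]
  exact sqrt_sq_add_sq_add_sq_le (by positivity) (by positivity) (by positivity)

end Lattice

/-! ## §4 The admissible frame: sum over the pieces -/

/-- `4^{(1-2)·n} = (4^n)⁻¹`, `4^{(3-2)·n} = 4^n` (the order-`1` and order-`3` weights of `FrameOK`). -/
theorem four_zpow_one_sub_two_mul (n : ℕ) : (4 : ℝ) ^ ((((1 : ℕ) : ℤ) - 2) * (n : ℤ)) = ((4 : ℝ) ^ n)⁻¹ := by
  rw [Nat.cast_one, show ((1 : ℤ) - 2) * (n : ℤ) = -(n : ℤ) by ring, zpow_neg, zpow_natCast]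

/-- `4^{(3-2)·n} = 4^n`. -/
theorem four_zpow_three_sub_two_mul (n : ℕ) : (4 : ℝ) ^ ((((3 : ℕ) : ℤ) - 2) * (n : ℤ)) = (4 : ℝ) ^ n := by
  rw [show (((3 : ℕ) : ℤ) - 2) * (n : ℤ) = (n : ℤ) by push_cast; ring, zpow_natCast]

/-- **The first moment of an admissible frame's position kernel**: for `FrameOK R U N μ K` with `Gfr j ≥ 0`, every direction `j` and every `L`,
`Σ_z |z̃_j|·‖Ǩ_L(z)‖ ≤ (N+1)·U²·6·(π·Gfr1/2 + π²·Gfr2/(2√2) + π³·Gfr3/8)` — piece `n` is read at its own scale `R = 4ⁿ` with the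
`j = 1, 2, 3` laws only (uniform in `n`), and the pieces are summed. -/
theorem sum_abs_mul_norm_framePosKernel_le_of_frameOK {L : ℕ} [NeZero L] {R : RenConsts} (hR : ∀ j, 0 ≤ R.Gfr j) {U : ℝ} {N : ℕ}
    {μ : ℝ} {K : TrigPolyC4v} (hK : FrameOK R U N μ K) (j : Fin 2) :
    ∑ z : TorusSite 2 L, |((z j).valMinAbs : ℝ)| * ‖framePosKernel L K z‖ ≤
      ((N : ℝ) + 1) * U ^ 2 * (6 * (Real.pi * R.Gfr 1 / 2 + Real.pi ^ 2 * R.Gfr 2 / (2 * Real.sqrt 2) + Real.pi ^ 3 * R.Gfr 3 / 8)) := by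
  obtain ⟨-, Kp, heval, hpieces⟩ := hK
  have hπ := Real.pi_pos
  have hsq2 : (0 : ℝ) < Real.sqrt 2 := Real.sqrt_pos.2 (by norm_num)
  -- piece by piece at scale `R = 4ⁿ`
  have hpiece : ∀ n ∈ range (N + 1), ∑ z : TorusSite 2 L, |((z j).valMinAbs : ℝ)| * ‖framePosKernel L (Kp n) z‖ ≤
      U ^ 2 * (6 * (Real.pi * R.Gfr 1 / 2 + Real.pi ^ 2 * R.Gfr 2 / (2 * Real.sqrt 2) + Real.pi ^ 3 * R.Gfr 3 / 8)) := by
    intro n hn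
    have hnN : n ≤ N := Nat.lt_succ_iff.1 (mem_range.1 hn)
    have h4 : (0 : ℝ) < (4 : ℝ) ^ n := by positivity
    have hRn : 1 ≤ 4 ^ n := Nat.one_le_pow _ _ (by norm_num)
    have h1 : ∀ q, ‖iteratedFDeriv ℝ 1 (evalM (Kp n)) q‖ ≤ R.Gfr 1 * U ^ 2 * ((4 : ℝ) ^ n)⁻¹ := fun q => by
      have h := hpieces n hnN 1 (by norm_num) q
      rwa [four_zpow_one_sub_two_mul, uPow_succ 0 U] at h
    have h2 : ∀ q, ‖iteratedFDeriv ℝ 2 (evalM (Kp n)) q‖ ≤ R.Gfr 2 * U ^ 2 := fun q => by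
      have h := hpieces n hnN 2 (by norm_num) q
      rwa [four_zpow_two_sub_two_mul, mul_one, uPow_succ 1 U] at h
    have h3 : ∀ q, ‖iteratedFDeriv ℝ 3 (evalM (Kp n)) q‖ ≤ R.Gfr 3 * U ^ 2 * (4 : ℝ) ^ n := fun q => by
      have h := hpieces n hnN 3 (by norm_num) q
      rwa [four_zpow_three_sub_two_mul, uPow_succ 2 U] at h
    have h := sum_abs_mul_norm_framePosKernel_le_of_derivs (L := L) (Kp n) (by have := hR 1; positivity) (by have := hR 2; positivity)
      (by have := hR 3; positivity) h1 h2 h3 hRn j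
    refine h.trans (le_of_eq ?_)
    push_cast
    field_simp
  simp_rw [framePosKernel_eq_sum_of_eval K (range (N + 1)) Kp heval]
  calc ∑ z : TorusSite 2 L, |((z j).valMinAbs : ℝ)| * ‖∑ n ∈ range (N + 1), framePosKernel L (Kp n) z‖
      ≤ ∑ z : TorusSite 2 L, ∑ n ∈ range (N + 1), |((z j).valMinAbs : ℝ)| * ‖framePosKernel L (Kp n) z‖ :=
        sum_le_sum fun z _ => by rw [← mul_sum]; exact mul_le_mul_of_nonneg_left (norm_sum_le _ _) (abs_nonneg _)
    _ = ∑ n ∈ range (N + 1), ∑ z : TorusSite 2 L, |((z j).valMinAbs : ℝ)| * ‖framePosKernel L (Kp n) z‖ := sum_comm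
    _ ≤ ∑ _n ∈ range (N + 1), U ^ 2 * (6 * (Real.pi * R.Gfr 1 / 2 + Real.pi ^ 2 * R.Gfr 2 / (2 * Real.sqrt 2) + Real.pi ^ 3 * R.Gfr 3 / 8)) :=
        sum_le_sum hpiece
    _ = _ := by rw [sum_const, card_range, nsmul_eq_mul]; push_cast; ring

end Summit.HubbardSuperconductivity.HubbardSuperconductivity.Theorems.EngineV8

end
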